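import Mathlib
import HarnessLib
import Summits.RiemannHypothesis.RiemannHypothesis.Theorems.IntegerScrewSmoothSectorDefs

/-!
# Route `SmoothSectorHardy` — the objects of K1a/K1b: the profile DEVIATION `Ψ` and the profile
# FUNCTION `H` (stmt-RiemannHypothesis-21565 / 21567)

For a generator `g` with lattice profile `h = latticeProfile g` and plateau
`h₀ = latticePlateau g = −g(0)/2` (tree `Theorems/IntegerScrewSmoothSectorDefs.lean`):

* `profileDev g = 1_{(0,1)}·(h − h₀)` (complex-valued) — the function whose Mellin transform
  `P(w) = ∫₀¹ y^{w−1}(h(y) − h₀) dy` carries the analytic continuation in K1a;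
* `profileFun g = 1_{(0,1)}(h − h₀) − h₀·1_{[1,∞)}` — VERBATIM the function inside the `mellin`
  of item 21565 `ProfileMellinFormula` (so `MellinConvergent (profileFun g) w` is its hypothesis);

and the pointwise identities `h = Ψ + h₀·1_{(0,1)}` on `(0,∞)` (needs `g(1) = 0`) and
`H = Ψ − h₀·1_{[1,∞)}`.  Definitions + elementary lemmas only.  RH-free; nothing here bears on
the truth of RH.
-/

set_option linter.dupNamespace false

noncomputable section

namespace Summit.RiemannHypothesis.RiemannHypothesis.Theorems.SmoothSectorHardy

open MeasureTheory Set
open Summit.RiemannHypothesis.RiemannHypothesis.Theorems.IntegerScrew (latticeProfile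
  latticePlateau)

/-- The profile DEVIATION `Ψ = 1_{(0,1)}·(h − h₀)` (complex-valued). [folklore] -/
def profileDev (g : ℝ → ℝ) : ℝ → ℂ :=
  (Ioo (0:ℝ) 1).indicator fun y => ((latticeProfile g y - latticePlateau g : ℝ) : ℂ)

/-- The profile FUNCTION `H = 1_{(0,1)}(h − h₀) − h₀·1_{[1,∞)}` — verbatim the function inside
item 21565's `mellin`. [folklore] -/
def profileFun (g : ℝ → ℝ) : ℝ → ℂ := fun y =>
  (((Ioo (0:ℝ) 1).indicator (fun y => latticeProfile g y - latticePlateau g) y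
    - (Ici (1:ℝ)).indicator (fun _ => latticePlateau g) y : ℝ) : ℂ)

/-- `h(y) = 0` for `y > 1` (empty lattice sum). [folklore] -/
theorem latticeProfile_eq_zero_of_one_lt (g : ℝ → ℝ) {y : ℝ} (hy : 1 < y) :
    latticeProfile g y = 0 := by
  have h : ⌊1 / y⌋₊ = 0 := Nat.floor_eq_zero.mpr (by rw [div_lt_one (by linarith)]; exact hy)
  unfold latticeProfile
  rw [h]; simp

/-- `h(1) = g(1)`. [folklore] -/
theorem latticeProfile_one (g : ℝ → ℝ) : latticeProfile g 1 = g 1 := by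
  unfold latticeProfile
  simp

/-- On `(0,∞)`, for `g(1) = 0`: `h = Ψ + h₀·1_{(0,1)}`. [folklore] -/
theorem latticeProfile_ofReal_eq_profileDev_add {g : ℝ → ℝ} (h1 : g 1 = 0) {y : ℝ} (hy : 0 < y) :
    ((latticeProfile g y : ℝ) : ℂ)
      = profileDev g y + (Ioo (0:ℝ) 1).indicator (fun _ => ((latticePlateau g : ℝ) : ℂ)) y := by
  by_cases hy1 : y ∈ Ioo (0:ℝ) 1
  · rw [profileDev, indicator_of_mem hy1, indicator_of_mem hy1]; push_cast; ring
  · rw [profileDev, indicator_of_notMem hy1, indicator_of_notMem hy1, zero_add]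
    have hy' : 1 ≤ y := by
      by_contra h
      exact hy1 ⟨hy, not_le.mp h⟩
    rcases eq_or_lt_of_le hy' with h | h
    · rw [← h, latticeProfile_one, h1]; simp
    · rw [latticeProfile_eq_zero_of_one_lt g h]; simp

/-- `H = Ψ − h₀·1_{[1,∞)}` pointwise. [folklore] -/
theorem profileFun_eq_profileDev_sub (g : ℝ → ℝ) (y : ℝ) :
    profileFun g y = profileDev g y - (Ici (1:ℝ)).indicator (fun _ => ((latticePlateau g : ℝ) : ℂ)) y := by
  unfold profileFun profileDev
  by_cases hy1 : y ∈ Ioo (0:ℝ) 1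
  · have hy2 : y ∉ Ici (1:ℝ) := fun h => (not_lt.mpr (mem_Ici.mp h)) hy1.2
    rw [indicator_of_mem hy1, indicator_of_mem hy1, indicator_of_notMem hy2,
      indicator_of_notMem hy2]
    push_cast; ring
  · rw [indicator_of_notMem hy1, indicator_of_notMem hy1]
    by_cases hy2 : y ∈ Ici (1:ℝ)
    · rw [indicator_of_mem hy2, indicator_of_mem hy2]; push_cast; ring
    · rw [indicator_of_notMem hy2, indicator_of_notMem hy2]; simp

end Summit.RiemannHypothesis.RiemannHypothesis.Theorems.SmoothSectorHardy

end
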